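import Literature.NumberTheory.Sieve.SmoothParityMinorArcs
import Literature.NumberTheory.Sieve.SmoothEndgameMinorSaddle
import HarnessLib

/-!
# Parity-class friable ternary counts: the minor arcs with saddle-size junk terms

Topic `Literature/NumberTheory/Sieve`, namespace `Literature.NumberTheory.Sieve.SmoothArcs`; a PROVED variant of
`SmoothProfileMinor` / `SmoothParityMinorArcs` ([Harper2016, Theorems 1, 2 and §5]) in which the tree's minor-arc
majorant `B(x, R) = C (log x)³ y^{5/2(1−α)} R^{−1/2+3/2(1−α)} 𝓟(x) + 164 (1 + log x)² y² x^{9/10} + 64 x/R³ + 1` is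
replaced by
`B'(x, R) = C (log x)³ y^{5/2(1−α)} R^{−1/2+3/2(1−α)} 𝓟(x) + 164 (1 + log x)² y² x^{9/10} + 32 x^α ζ(α,y)/R² + 1`
(`Endgame.norm_smoothWeightSum_le_of_minor_saddle`): the junk `64 x/R³` of the Abel summation is not negligible against
`𝓟(x) ≈ x^{1−1/K+o(1)}` in the polylog regime `y = (log x)^K` with `R` a power of `log x`, whereas
`32 x^α ζ(α,y)/R² = 32 √φ₂ 𝓟(x)/R²` is.

* `norm_classProfileSum_free_le_of_minor_saddle` — the free-variable profile-sum bound
  `‖classProfileSum X y 1 0 c θ‖ ≤ B'(x, R) Σ_ℓ ‖c_ℓ‖ + 8 Ψ(X, y) ‖c‖_W/R³` (as `norm_classProfileSum_free_le_of_minor_card`);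
* `parity_minor_arcs_of_minor_saddle` — the ternary minor-arc bound of `parity_minor_arcs_of_minor` with the free
  variable's supremum `S₃ = B'(2X₃, R) Σ_ℓ ‖c₃ ℓ‖ + 8 Ψ(X₃, y) ‖c₃‖_W/R³`.

The proofs are those of the un-primed theorems verbatim, with the new majorant threaded through.

## References

* A. J. Harper, *Minor arcs, mean values, and restriction theory for exponential sums over smooth numbers*,
  Compositio Math. 152 (2016) 1121–1158, Theorems 1, 2 and §5 [Harper2016].
-/

noncomputable section

open Finset Real Complex
open scoped FourierTransform

namespace Literature.NumberTheory.Sieve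

namespace SmoothArcs

open TwistedWeight Endgame

/-! ### The free variable -/

/-- **Minor-arc bound for the profile sums of a free friable variable, saddle-size junk.** In Harper's range
`x ≥ x₀`, `(log x)^8 ≤ y`, `log y ≤ ½ (log x)^{1/6}`, `y^{80} ≤ x`, for `x/2 ≤ X ≤ x`, `1 ≤ R ≤ x^{1/10}`, a `W`-class
profile `c` and every `θ` with `|θ − a/q| > 2R/x` for all `1 ≤ q ≤ R`, `a ∈ ℤ`:
`‖classProfileSum X y 1 0 c θ‖ ≤ B'(x, R) Σ_ℓ ‖c_ℓ‖ + 8 Ψ(X, y) ‖c‖_W / R³`,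
`B'(x, R) = C (log x)³ y^{5/2(1−α)} R^{−1/2+3/2(1−α)} 𝓟(x) + 164 (1 + log x)² y² x^{9/10} + 32 x^α ζ(α,y)/R² + 1`
(`norm_classProfileSum_one_le` with `norm_smoothWeightSum_le_of_minor_saddle` on the window `|θ' − θ| ≤ R/x` and the
trivial bound `Ψ(X, y)` elsewhere). [cite: Harper2016, Theorem 1 and §5] -/
theorem norm_classProfileSum_free_le_of_minor_saddle :
    ∃ C x₀ : ℝ, 0 < C ∧ ∀ (x : ℝ) (y : ℕ), x₀ ≤ x → Real.log x ^ 8 ≤ y →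
      Real.log y ≤ 1 / 2 * Real.log x ^ (1 / 6 : ℝ) → (y : ℝ) ^ 80 ≤ x → ∀ X : ℝ, x / 2 ≤ X → X ≤ x →
      ∀ R : ℝ, 1 ≤ R → R ≤ x ^ (1 / 10 : ℝ) →
      ∀ c : ℤ → ℂ, Summable (fun ℓ : ℤ => ‖c ℓ‖ * (1 + |(ℓ : ℝ)|) ^ 3) →
      ∀ θ : ℝ, (∀ q : ℕ, 1 ≤ q → (q : ℝ) ≤ R → ∀ a : ℤ, 2 * R / x < |θ - a / q|) →
        ‖classProfileSum X y 1 0 c θ‖ ≤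
          (C * Real.log x ^ 3 * (y : ℝ) ^ (5 / 2 * (1 - saddlePoint x y)) *
              R ^ (-(1 / 2 : ℝ) + 3 / 2 * (1 - saddlePoint x y)) *
              (x ^ saddlePoint x y * (smoothZeta (saddlePoint x y) y / Real.sqrt (saddlePhi₂ (saddlePoint x y) y))) +
            164 * (1 + Real.log x) ^ 2 * (y : ℝ) ^ 2 * x ^ (9 / 10 : ℝ) +
            32 * (x ^ saddlePoint x y * smoothZeta (saddlePoint x y) y) / R ^ 2 + 1) * (∑' ℓ : ℤ, ‖c ℓ‖) +
          8 * ((Nat.smoothNumbersUpTo ⌊X⌋₊ (y + 1)).card : ℝ) * profileNorm c / R ^ 3 := by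
  obtain ⟨C, x₀, hC, hmain⟩ := norm_smoothWeightSum_le_of_minor_saddle
  refine ⟨C, max x₀ 2, hC, fun x y hx hy8 hylog hy80 X hXlo hXhi R hR1 hRx c hc θ hminor => ?_⟩
  have hx₀ : x₀ ≤ x := le_trans (le_max_left _ _) hx
  have hx2 : 2 ≤ x := le_trans (le_max_right _ _) hx
  have hx0 : 0 < x := by linarith
  have hX0 : 0 < X := by linarith
  have hR0 : 0 < R := by linarith
  have hρ : 0 < R / x := by positivity
  have hminor' : ∀ q : ℕ, 1 ≤ q → (q : ℝ) ≤ R → ∀ a : ℤ, R / x + R / x < |θ - a / q| := by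
    intro q hq hqR a
    have e : R / x + R / x = 2 * R / x := by ring
    rw [e]
    exact hminor q hq hqR a
  have h := norm_classProfileSum_one_le hc hX0 y hρ
    (fun θ' hθ' => hmain x y hx₀ hy8 hylog hy80 X hXlo hXhi R hR1 hRx θ' (minor_of_abs_sub_le hminor' hθ'))
    (fun θ' => norm_smoothWeightSum_le_card X y θ')
  refine h.trans (add_le_add le_rfl ?_)
  -- `(ρ X)³ ≥ (R/2)³`
  have hT : 0 ≤ ((Nat.smoothNumbersUpTo ⌊X⌋₊ (y + 1)).card : ℝ) * profileNorm c :=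
    mul_nonneg (Nat.cast_nonneg _) (profileNorm_nonneg c)
  have hρX : R / 2 ≤ R / x * X := by
    rw [div_mul_eq_mul_div, div_le_div_iff₀ two_pos hx0]
    nlinarith
  have h3 : (R / 2) ^ 3 ≤ (R / x * X) ^ 3 := pow_le_pow_left₀ (by positivity) hρX 3
  calc ((Nat.smoothNumbersUpTo ⌊X⌋₊ (y + 1)).card : ℝ) * profileNorm c / (R / x * X) ^ 3
      ≤ ((Nat.smoothNumbersUpTo ⌊X⌋₊ (y + 1)).card : ℝ) * profileNorm c / (R / 2) ^ 3 :=
        div_le_div_of_nonneg_left hT (by positivity) h3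
    _ = 8 * ((Nat.smoothNumbersUpTo ⌊X⌋₊ (y + 1)).card : ℝ) * profileNorm c / R ^ 3 := by
        field_simp
        ring

/-! ### The ternary minor arcs -/

/-- **Minor-arc bound for the parity-class ternary product of friable profile sums, saddle-size junk.** With
`𝓟(X) = X^α ζ(α,y)/√φ₂(α,y)` (`α = α(X, y)`), `V₁ = classProfileSum X₁ y 2 1 c₁`, `V₂ = classProfileSum X₂ y 2 1 c₂`,
`V₃ = classProfileSum X₃ y 1 0 c₃`: in Harper's regime at the three scales `X₁, X₂, X₃` and with `(log 2X₃)^8 ≤ y`, for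
`N₀ ≥ 1`, `σ = ±1`, `(d₁, N₀) = (d₂, N₀) = 1`, `1 ≤ R ≤ (2X₃)^{1/10}`, profiles with `|p_{c_i}| ≤ 1` and `‖c₃‖_W < ∞`, every
`T ⊆ [0, N₀)` whose points satisfy `|r/N₀ − a/q| > R/X₃` for all `1 ≤ q ≤ R`, `a ∈ ℤ`:
`‖Σ_{r ∈ T} V₁(d₁r/N₀) V₂(σd₂r/N₀) conj V₃(r/N₀)‖ ≤ C (log X₁ log X₂ log X₃)⁸ (1+N₀/X₁)^{2/5} (1+N₀/X₂)^{2/5}`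
`· (1+N₀/X₃)^{1/5} 𝓟(X₁) 𝓟(X₂) 𝓟(X₃)^{1/2} S₃^{1/2}`, `S₃ = B'(2X₃, R) Σ_ℓ ‖c₃ ℓ‖ + 8 Ψ(X₃, y) ‖c₃‖_W/R³`,
`B'(x, R) = C (log x)³ y^{5/2(1−α)} R^{−1/2+3/2(1−α)} 𝓟(x) + 164 (1 + log x)² y² x^{9/10} + 32 x^α ζ(α,y)/R² + 1`
(`α = α(x, y)`).  Proof: Hölder `(5/2, 5/2, 5)` and oversampled restriction (`ternary_holder_restriction`) with the supremum of
the free factor from `norm_classProfileSum_free_le_of_minor_saddle` at the ambient scale `2X₃`.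
[cite: Harper2016, Theorems 1, 2 and §5] -/
theorem parity_minor_arcs_of_minor_saddle :
    ∃ C x₀ : ℝ, 0 < C ∧ ∀ (y : ℕ) (X₁ X₂ X₃ : ℝ),
      x₀ ≤ X₁ → Real.log X₁ ^ 8 ≤ (y : ℝ) → Real.log (y : ℝ) ≤ 1 / 2 * Real.log X₁ ^ (1 / 6 : ℝ) →
      (y : ℝ) ^ 200 ≤ X₁ → 1 - 1 / 10000 ≤ saddlePoint X₁ y →
      X₁ ^ ((39999 : ℝ) / 40000) ≤ ((Nat.smoothNumbersUpTo ⌊X₁⌋₊ (y + 1)).card : ℝ) →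
      x₀ ≤ X₂ → Real.log X₂ ^ 8 ≤ (y : ℝ) → Real.log (y : ℝ) ≤ 1 / 2 * Real.log X₂ ^ (1 / 6 : ℝ) →
      (y : ℝ) ^ 200 ≤ X₂ → 1 - 1 / 10000 ≤ saddlePoint X₂ y →
      X₂ ^ ((39999 : ℝ) / 40000) ≤ ((Nat.smoothNumbersUpTo ⌊X₂⌋₊ (y + 1)).card : ℝ) →
      x₀ ≤ X₃ → Real.log X₃ ^ 8 ≤ (y : ℝ) → Real.log (y : ℝ) ≤ 1 / 2 * Real.log X₃ ^ (1 / 6 : ℝ) →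
      (y : ℝ) ^ 200 ≤ X₃ → 1 - 1 / 10000 ≤ saddlePoint X₃ y →
      X₃ ^ ((39999 : ℝ) / 40000) ≤ ((Nat.smoothNumbersUpTo ⌊X₃⌋₊ (y + 1)).card : ℝ) →
      Real.log (2 * X₃) ^ 8 ≤ (y : ℝ) →
      ∀ (N₀ : ℕ), 1 ≤ N₀ → ∀ (σ : ℤ), (σ = 1 ∨ σ = -1) → ∀ (d₁ d₂ : ℕ), IsCoprime (d₁ : ℤ) N₀ →
      IsCoprime (d₂ : ℤ) N₀ → ∀ (R : ℝ), 1 ≤ R → R ≤ (2 * X₃) ^ (1 / 10 : ℝ) →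
      ∀ (c₁ c₂ c₃ : ℤ → ℂ), (∀ v : ℝ, ‖profileFn c₁ v‖ ≤ 1) → (∀ v : ℝ, ‖profileFn c₂ v‖ ≤ 1) →
      (∀ v : ℝ, ‖profileFn c₃ v‖ ≤ 1) → Summable (fun ℓ : ℤ => ‖c₃ ℓ‖ * (1 + |(ℓ : ℝ)|) ^ 3) →
      ∀ (T : Finset ℕ), T ⊆ Finset.range N₀ →
      (∀ r ∈ T, ∀ q : ℕ, 1 ≤ q → (q : ℝ) ≤ R → ∀ a : ℤ, R / X₃ < |(r : ℝ) / N₀ - a / q|) →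
        ‖∑ r ∈ T, classProfileSum X₁ y 2 1 c₁ ((d₁ : ℝ) * r / N₀) *
            classProfileSum X₂ y 2 1 c₂ ((σ : ℝ) * d₂ * r / N₀) *
            starRingEnd ℂ (classProfileSum X₃ y 1 0 c₃ ((r : ℝ) / N₀))‖ ≤
          C * (Real.log X₁ * Real.log X₂ * Real.log X₃) ^ (8 : ℕ) *
            (1 + (N₀ : ℝ) / X₁) ^ (2 / 5 : ℝ) * (1 + (N₀ : ℝ) / X₂) ^ (2 / 5 : ℝ) *
            (1 + (N₀ : ℝ) / X₃) ^ (1 / 5 : ℝ) *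
            (X₁ ^ saddlePoint X₁ y *
              (smoothZeta (saddlePoint X₁ y) y / Real.sqrt (saddlePhi₂ (saddlePoint X₁ y) y))) *
            (X₂ ^ saddlePoint X₂ y *
              (smoothZeta (saddlePoint X₂ y) y / Real.sqrt (saddlePhi₂ (saddlePoint X₂ y) y))) *
            (X₃ ^ saddlePoint X₃ y *
              (smoothZeta (saddlePoint X₃ y) y / Real.sqrt (saddlePhi₂ (saddlePoint X₃ y) y))) ^ (1 / 2 : ℝ) *
            ((C * Real.log (2 * X₃) ^ 3 * (y : ℝ) ^ (5 / 2 * (1 - saddlePoint (2 * X₃) y)) *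
                  R ^ (-(1 / 2 : ℝ) + 3 / 2 * (1 - saddlePoint (2 * X₃) y)) *
                  ((2 * X₃) ^ saddlePoint (2 * X₃) y * (smoothZeta (saddlePoint (2 * X₃) y) y /
                    Real.sqrt (saddlePhi₂ (saddlePoint (2 * X₃) y) y))) +
                164 * (1 + Real.log (2 * X₃)) ^ 2 * (y : ℝ) ^ 2 * (2 * X₃) ^ (9 / 10 : ℝ) +
                32 * ((2 * X₃) ^ saddlePoint (2 * X₃) y * smoothZeta (saddlePoint (2 * X₃) y) y) / R ^ 2 + 1) *
                (∑' ℓ : ℤ, ‖c₃ ℓ‖) +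
              8 * ((Nat.smoothNumbersUpTo ⌊X₃⌋₊ (y + 1)).card : ℝ) * profileNorm c₃ / R ^ 3) ^ (1 / 2 : ℝ) := by
  obtain ⟨C_H, x_H, hC_H, hH⟩ := ternary_holder_restriction
  obtain ⟨C_M, x_M, hC_M, hM⟩ := norm_classProfileSum_free_le_of_minor_saddle
  refine ⟨max C_H C_M, max (max x_H x_M) 2, lt_max_of_lt_left hC_H, ?_⟩
  intro y X₁ X₂ X₃ hx₁ hy8₁ hy6₁ hy200₁ hα₁ hΨ₁ hx₂ hy8₂ hy6₂ hy200₂ hα₂ hΨ₂ hx₃ hy8₃ hy6₃ hy200₃ hα₃ hΨ₃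
    hy8₃' N₀ hN₀ σ hσ d₁ d₂ hd₁ hd₂ R hR1 hRX c₁ c₂ c₃ hp₁ hp₂ hp₃ hc₃ T hT hminor
  simp only [max_le_iff] at hx₁ hx₂ hx₃
  obtain ⟨⟨hxH₁, -⟩, h2₁⟩ := hx₁
  obtain ⟨⟨hxH₂, -⟩, h2₂⟩ := hx₂
  obtain ⟨⟨hxH₃, hxM₃⟩, h2₃⟩ := hx₃
  have hX₃0 : 0 < X₃ := by linarith
  have hR0 : 0 < R := by linarith
  -- `y ≥ 2` (else `α(X₃, y) = 0`)
  have hy2 : 2 ≤ y := by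
    by_contra hlt
    rw [saddlePoint_of_not (fun h => hlt h.2)] at hα₃
    norm_num at hα₃
  have hy1 : (1 : ℝ) ≤ y := by exact_mod_cast (by omega : 1 ≤ y)
  -- positivity of the data at the scales (atoms for `positivity`)
  have hX₁0 : 0 < X₁ := by linarith
  have hX₂0 : 0 < X₂ := by linarith
  have hζ₁ : 0 < smoothZeta (saddlePoint X₁ y) y := smoothZeta_pos (saddlePoint_pos (by linarith) hy2)
  have hζ₂ : 0 < smoothZeta (saddlePoint X₂ y) y := smoothZeta_pos (saddlePoint_pos (by linarith) hy2)
  have hζ₃ : 0 < smoothZeta (saddlePoint X₃ y) y := smoothZeta_pos (saddlePoint_pos (by linarith) hy2)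
  have hζ' : 0 < smoothZeta (saddlePoint (2 * X₃) y) y := smoothZeta_pos (saddlePoint_pos (by linarith) hy2)
  have hL' : 0 ≤ Real.log (2 * X₃) := Real.log_nonneg (by linarith)
  have hsum₃ : 0 ≤ ∑' ℓ : ℤ, ‖c₃ ℓ‖ := tsum_nonneg fun _ => norm_nonneg _
  have hpN : 0 ≤ profileNorm c₃ := profileNorm_nonneg c₃
  -- the regime of the minor-arc lemma at the ambient scale `2X₃`
  have hy6' : Real.log (y : ℝ) ≤ 1 / 2 * Real.log (2 * X₃) ^ (1 / 6 : ℝ) :=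
    hy6₃.trans (mul_le_mul_of_nonneg_left (Real.rpow_le_rpow (Real.log_nonneg (by linarith))
      (Real.log_le_log hX₃0 (by linarith)) (by norm_num)) (by norm_num))
  have hy80' : (y : ℝ) ^ 80 ≤ 2 * X₃ :=
    ((pow_le_pow_right₀ hy1 (by norm_num : 80 ≤ 200)).trans hy200₃).trans (by linarith)
  -- `σ d₂` is coprime to `N₀`
  have hd₂' : IsCoprime (σ * (d₂ : ℤ)) (N₀ : ℤ) := by
    rcases hσ with rfl | rfl
    · simpa using hd₂
    · simpa using hd₂.neg_left
  -- the supremum of the free factor on `T`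
  have hsup : ∀ r ∈ T, ‖∑ n ∈ Nat.smoothNumbersUpTo ⌊X₃⌋₊ (y + 1),
      profileFn c₃ (n / X₃) * (𝐞 ((n : ℝ) * (((1 : ℤ) * r : ℝ) / N₀)) : ℂ)‖ ≤
      (max C_H C_M * Real.log (2 * X₃) ^ 3 * (y : ℝ) ^ (5 / 2 * (1 - saddlePoint (2 * X₃) y)) *
            R ^ (-(1 / 2 : ℝ) + 3 / 2 * (1 - saddlePoint (2 * X₃) y)) *
            ((2 * X₃) ^ saddlePoint (2 * X₃) y * (smoothZeta (saddlePoint (2 * X₃) y) y /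
              Real.sqrt (saddlePhi₂ (saddlePoint (2 * X₃) y) y))) +
          164 * (1 + Real.log (2 * X₃)) ^ 2 * (y : ℝ) ^ 2 * (2 * X₃) ^ (9 / 10 : ℝ) +
          32 * ((2 * X₃) ^ saddlePoint (2 * X₃) y * smoothZeta (saddlePoint (2 * X₃) y) y) / R ^ 2 + 1) *
          (∑' ℓ : ℤ, ‖c₃ ℓ‖) +
        8 * ((Nat.smoothNumbersUpTo ⌊X₃⌋₊ (y + 1)).card : ℝ) * profileNorm c₃ / R ^ 3 := by
    intro r hr
    rw [Int.cast_one, one_mul, ← classProfileSum_one_zero_eq_sum]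
    have hmin : ∀ q : ℕ, 1 ≤ q → (q : ℝ) ≤ R → ∀ a : ℤ, 2 * R / (2 * X₃) < |(r : ℝ) / N₀ - a / q| := by
      intro q hq hqR a
      rw [mul_div_mul_left R X₃ two_ne_zero]
      exact hminor r hr q hq hqR a
    refine (hM (2 * X₃) y (by linarith) hy8₃' hy6' hy80' X₃ (by linarith) (by linarith) R hR1 hRX c₃ hc₃ _
      hmin).trans ?_
    gcongr
    exact le_max_right _ _
  -- Hölder and restriction
  have hHT := hH y X₁ X₂ X₃ hxH₁ hy8₁ hy6₁ hy200₁ hα₁ hΨ₁ hxH₂ hy8₂ hy6₂ hy200₂ hα₂ hΨ₂ hxH₃ hy8₃ hy6₃ hy200₃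
    hα₃ hΨ₃ N₀ hN₀ (d₁ : ℤ) (σ * (d₂ : ℤ)) 1 hd₁ hd₂' isCoprime_one_left
    (fun n => if Odd n then profileFn c₁ (n / X₁) else 0) (fun n => if Odd n then profileFn c₂ (n / X₂) else 0)
    (fun n => profileFn c₃ (n / X₃)) (norm_ite_profileFn_le_one hp₁ X₁) (norm_ite_profileFn_le_one hp₂ X₂)
    (fun n => hp₃ _) T hT _ (by positivity) hsup
  simp only [Int.cast_natCast, Int.cast_mul, Int.cast_one, one_mul] at hHT
  refine (norm_sum_le _ _).trans ?_
  simp only [norm_mul, Complex.norm_conj, classProfileSum_two_one_eq_sum_ite, classProfileSum_one_zero_eq_sum]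
  refine hHT.trans ?_
  gcongr
  exact le_max_left _ _

end SmoothArcs

end Literature.NumberTheory.Sieve

end
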